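import Literature.NumberTheory.Sieve.FriedlanderIwaniecPrimesAngularPartition
import Mathlib.Analysis.Fourier.AddCircle
import Mathlib.NumberTheory.ZetaValues
import Mathlib.Analysis.Real.Pi.Bounds
import HarnessLib

/-!
# Friedlander–Iwaniec, *The polynomial `X² + Y⁴` captures its primes*, §23/(1.7): sectors through the angular characters `(z/|z|)^k`

Family `parity` (rung F-SPIN, the "stripping (23.1) → (23.3)" of Theorem 2). Source: J. Friedlander,
H. Iwaniec, Ann. of Math. (2) 148 (1998), 945–1040 [FriedlanderIwaniecAnnals1998], §23 after (23.3):
"the presence of the Hecke character `ψ` offers welcome flexibility by means of which one can create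
simpler objects such as (23.3) `λ₀(n) = Σ_{r²+s²=n} (s/r)` where `r, s` are both positive and `r` is odd.
Here one can also put `r, s` into a prescribed sector and one can require these to be in fixed residue
classes to a given modulus. Theorem 2 concerns the eigenvalue (23.1) stripped to (23.3)." (Also §1 after
(1.7): "by our method (1.7) can be established for `r, s` in any fixed arithmetic progressions and
lying in a given sector".)

Putting `z` "into a prescribed sector" is done with the angular characters `(z/|z|)^k = e^{ik arg z}`
of (17.17): a smooth `2π`-periodic weight `g(arg z)` is expanded in its Fourier series. This file
supplies that ANALYTIC input, proved from Mathlib's Fourier theory on `AddCircle`: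

* `hasSum_fourier_of_periodic` — a `2π`-periodic `C³` function `g` with `|g| ≤ B₀`, `|g'''| ≤ B₃`
  has `g(θ) = Σ_{k ∈ ℤ} ĝ(k) e^{ikθ}` (`θ ∈ (-π, π]`) with `|ĝ(0)| ≤ B₀`, `|ĝ(k)| ≤ B₃/|k|³`
  (three integrations by parts [Mathlib: `fourierCoeffOn_of_hasDerivAt`], pointwise convergence
  [Mathlib: `has_pointwise_sum_fourier_series_of_summable`]).
* `quadWin c q Δ` — a smooth `2π`-periodic window for the quarter-arc `(q, q + π/2)`: equal to `1` on
  `[q + Δ, q + π/2 - Δ]`, to `0` off `(q, q + π/2)` (within the period window `(c, c + 2π]`), values in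
  `[0, 1]`, with `|quadWin'''| ≤ 2M/Δ³` (built from the tree's `fiStep` and `angPeriodize`), and its
  Fourier expansion `hasSum_fourier_quadWin`.

## References

* J. Friedlander, H. Iwaniec, Ann. of Math. (2) 148 (1998), 945–1040, §23 (23.1)–(23.3), (17.17).
  [FriedlanderIwaniecAnnals1998]

## Tree / Mathlib

Tree: `fiStep`, `contDiff_fiStep`, `deriv_fiStep`, `deriv_deriv_fiStep`, `fiStep_eq_zero`, `fiStep_eq_one`,
`fiStep_nonneg`, `fiStep_le_one`, `fiStep_anti_left`, `exists_bound_iteratedFDeriv_smoothTransition`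
(`…BilinearPartition`, `…SmoothCutoff`), `angPeriodize`, `angPeriodize_periodic`, `contDiff_angPeriodize`,
`deriv_angPeriodize_eq`, `WindowSupp`, `WindowSupp.deriv` (`…AngularPartition`). Mathlib: `fourierCoeff`,
`fourierCoeff_liftIoc_eq`, `fourierCoeffOn_of_hasDerivAt`, `fourierCoeffOn_eq_integral`,
`has_pointwise_sum_fourier_series_of_summable`, `AddCircle.liftIoc_continuous`, `Real.summable_one_div_int_pow`.
-/

noncomputable section

open Real Complex MeasureTheory Set
open scoped Topology

namespace Literature.NumberTheory.Sieve.FriedlanderIwaniecPrimes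

/-! ### Fourier series of a `2π`-periodic `C³` function -/

/-- The period interval `(-π, -π + 2π]`. [folklore] -/
private theorem hperiod : (-π : ℝ) < -π + 2 * π := lt_add_of_pos_right (-π) Real.two_pi_pos

/-- `‖fourier n x‖ = 1`. [folklore] -/
private theorem norm_fourier_apply {T : ℝ} (n : ℤ) (x : AddCircle T) : ‖fourier n x‖ = 1 := by
  rw [fourier_apply]; exact Circle.norm_coe _

/-- One integration by parts over a period: for `f` with `f(-π + 2π) = f(-π)` and continuous
derivative `f'`, `f̂(n) = f̂'(n)/(in)` (`n ≠ 0`). [folklore] -/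
private theorem fourierCoeffOn_period_of_hasDerivAt {f f' : ℝ → ℂ} {n : ℤ} (hn : n ≠ 0)
    (hf : ∀ x, HasDerivAt f (f' x) x) (hf' : Continuous f') (hper : f (-π + 2 * π) = f (-π)) :
    fourierCoeffOn hperiod f n = (1 / (I * n)) * fourierCoeffOn hperiod f' n := by
  rw [fourierCoeffOn_of_hasDerivAt hperiod hn (fun x _ => hf x) (hf'.intervalIntegrable _ _), hper,
    sub_self, mul_zero, zero_sub]
  have hπ : (π : ℂ) ≠ 0 := by exact_mod_cast Real.pi_pos.ne'
  have hn' : (n : ℂ) ≠ 0 := by exact_mod_cast hn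
  push_cast
  field_simp
  ring

/-- The size of a Fourier coefficient over a period: `‖f̂(n)‖ ≤ sup ‖f‖`. [folklore] -/
private theorem norm_fourierCoeffOn_period_le {f : ℝ → ℂ} {B : ℝ} (hB : ∀ x, ‖f x‖ ≤ B) (n : ℤ) :
    ‖fourierCoeffOn hperiod f n‖ ≤ B := by
  have hB0 : 0 ≤ B := (norm_nonneg _).trans (hB 0)
  rw [fourierCoeffOn_eq_integral, norm_smul]
  have hL : (-π + 2 * π) - (-π) = 2 * π := by ring
  have hint : ‖∫ x in (-π)..(-π + 2 * π), (fourier (-n)) (x : AddCircle (-π + 2 * π - -π)) • f x‖ ≤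
      B * |(-π + 2 * π) - (-π)| := by
    refine intervalIntegral.norm_integral_le_of_norm_le_const fun x _ => ?_
    rw [norm_smul, norm_fourier_apply, one_mul]
    exact hB x
  have hLpos : (0 : ℝ) < -π + 2 * π - -π := by linarith [Real.pi_pos]
  rw [abs_of_pos hLpos] at hint
  rw [Real.norm_eq_abs, abs_of_pos (one_div_pos.mpr hLpos)]
  calc _ ≤ 1 / (-π + 2 * π - -π) * (B * (-π + 2 * π - -π)) :=
        mul_le_mul_of_nonneg_left hint (one_div_pos.mpr hLpos).le
    _ = B := by field_simp

/-- `Σ_{k ∈ ℤ} 1/k² ≤ 4` (as a `HasSum` bound: the series of `1/k²` over `ℤ`, with the `k = 0` term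
equal to `0`, has a sum `≤ 4`). [cite: FriedlanderIwaniecAnnals1998, §23 after (23.3)] -/
theorem hasSum_one_div_int_sq : ∃ S : ℝ, S ≤ 4 ∧ HasSum (fun k : ℤ => 1 / (k : ℝ) ^ 2) S := by
  have h1 : HasSum (fun n : ℕ => 1 / (n : ℝ) ^ 2) (π ^ 2 / 6) := hasSum_zeta_two
  have h2 : HasSum (fun n : ℕ => 1 / ((n : ℝ) + 1) ^ 2) (π ^ 2 / 6) := by
    have := (hasSum_nat_add_iff' 1).mpr h1
    simp only [Finset.range_one, Finset.sum_singleton, Nat.cast_zero, ne_eq, OfNat.ofNat_ne_zero,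
      not_false_eq_true, zero_pow, div_zero, sub_zero] at this
    have e : (fun n : ℕ => 1 / ((n : ℝ) + 1) ^ 2) = fun n : ℕ => 1 / ((n + 1 : ℕ) : ℝ) ^ 2 := by
      funext n; push_cast; ring
    rw [e]; exact this
  have hπ : π < 3.15 := Real.pi_lt_d2
  refine ⟨π ^ 2 / 6 + π ^ 2 / 6, by nlinarith [Real.pi_pos], ?_⟩
  refine HasSum.of_nat_of_neg_add_one (f := fun k : ℤ => 1 / (k : ℝ) ^ 2) ?_ ?_
  · simpa using h1
  · convert h2 using 2 with n
    push_cast; ring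

/-- **Fourier expansion of a smooth periodic function in the angular characters.** Let `g : ℝ → ℝ`
be `2π`-periodic and `C³` with `|g| ≤ B₀` and `|g'''| ≤ B₃`. Then there are coefficients `ĝ : ℤ → ℂ`
with `|ĝ(0)| ≤ B₀`, `|ĝ(k)| ≤ B₃/|k|³` (`k ≠ 0`), and `g(θ) = Σ_k ĝ(k) e^{ikθ}` for every
`θ ∈ (-π, π]` (absolutely convergent). [cite: FriedlanderIwaniecAnnals1998, §23 after (23.3) ("put r, s into a prescribed sector" via (17.17))] -/
theorem hasSum_fourier_of_periodic {g : ℝ → ℝ} (hper : Function.Periodic g (2 * π))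
    (hg : ContDiff ℝ 3 g) {B₀ B₃ : ℝ} (h0 : ∀ u, |g u| ≤ B₀)
    (h3 : ∀ u, |deriv (deriv (deriv g)) u| ≤ B₃) :
    ∃ c : ℤ → ℂ, ‖c 0‖ ≤ B₀ ∧ (∀ k : ℤ, k ≠ 0 → ‖c k‖ ≤ B₃ / |(k : ℝ)| ^ 3) ∧
      (Summable fun k => ‖c k‖) ∧
      ∀ θ : ℝ, θ ∈ Set.Ioc (-π) π → HasSum (fun k : ℤ => c k * Complex.exp (k * θ * I)) (g θ) := by
  haveI : Fact (0 < 2 * π) := ⟨Real.two_pi_pos⟩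
  -- the three derivatives
  set g₁ := deriv g with hg₁
  set g₂ := deriv g₁ with hg₂
  set g₃ := deriv g₂ with hg₃
  have hg₁c : ContDiff ℝ 2 g₁ := hg.deriv'
  have hg₂c : ContDiff ℝ 1 g₂ := hg₁c.deriv'
  have hg₃c : ContDiff ℝ 0 g₃ := hg₂c.deriv'
  have hd₀ : ∀ x, HasDerivAt g (g₁ x) x := fun x =>
    ((hg.differentiable (by norm_num)) x).hasDerivAt
  have hd₁ : ∀ x, HasDerivAt g₁ (g₂ x) x := fun x =>
    ((hg₁c.differentiable (by norm_num)) x).hasDerivAt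
  have hd₂ : ∀ x, HasDerivAt g₂ (g₃ x) x := fun x =>
    ((hg₂c.differentiable (by norm_num)) x).hasDerivAt
  have hperD : ∀ {f : ℝ → ℝ}, Function.Periodic f (2 * π) → Function.Periodic (deriv f) (2 * π) := by
    intro f hf x
    have e : (fun y => f (y + 2 * π)) = f := funext hf
    rw [← deriv_comp_add_const, e]
  have hp₁ : Function.Periodic g₁ (2 * π) := hperD hper
  have hp₂ : Function.Periodic g₂ (2 * π) := hperD hp₁
  -- complexifications
  set G : ℝ → ℂ := fun u => (g u : ℂ) with hG
  set G₁ : ℝ → ℂ := fun u => (g₁ u : ℂ)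
  set G₂ : ℝ → ℂ := fun u => (g₂ u : ℂ)
  set G₃ : ℝ → ℂ := fun u => (g₃ u : ℂ)
  have hD₀ : ∀ x, HasDerivAt G (G₁ x) x := fun x => (hd₀ x).ofReal_comp
  have hD₁ : ∀ x, HasDerivAt G₁ (G₂ x) x := fun x => (hd₁ x).ofReal_comp
  have hD₂ : ∀ x, HasDerivAt G₂ (G₃ x) x := fun x => (hd₂ x).ofReal_comp
  have hG₁cont : Continuous G₁ := continuous_ofReal.comp (hg₁c.continuous)
  have hG₂cont : Continuous G₂ := continuous_ofReal.comp (hg₂c.continuous)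
  have hG₃cont : Continuous G₃ := continuous_ofReal.comp (hg₃c.continuous)
  -- the lift to the circle and its Fourier coefficients
  set F : AddCircle (2 * π) → ℂ := AddCircle.liftIoc (2 * π) (-π) G with hF
  have hFc : Continuous F := by
    refine AddCircle.liftIoc_continuous ?_ (continuous_ofReal.comp hg.continuous).continuousOn
    change (g (-π) : ℂ) = (g (-π + 2 * π) : ℂ)
    rw [hper]
  set Fc : C(AddCircle (2 * π), ℂ) := ⟨F, hFc⟩
  set c : ℤ → ℂ := fourierCoeff (Fc : AddCircle (2 * π) → ℂ) with hc
  have hcoeff : ∀ n, c n = fourierCoeffOn hperiod G n := fun n => fourierCoeff_liftIoc_eq G n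
  -- the bounds
  have hc0 : ‖c 0‖ ≤ B₀ := by
    rw [hcoeff]
    exact norm_fourierCoeffOn_period_le (fun x => by
      change ‖(g x : ℂ)‖ ≤ B₀; rw [Complex.norm_real, Real.norm_eq_abs]; exact h0 x) 0
  have hck : ∀ k : ℤ, k ≠ 0 → ‖c k‖ ≤ B₃ / |(k : ℝ)| ^ 3 := by
    intro k hk
    rw [hcoeff, fourierCoeffOn_period_of_hasDerivAt hk hD₀ hG₁cont (by change (g _ : ℂ) = _; rw [hper]),
      fourierCoeffOn_period_of_hasDerivAt hk hD₁ hG₂cont (by change (g₁ _ : ℂ) = _; rw [hp₁]),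
      fourierCoeffOn_period_of_hasDerivAt hk hD₂ hG₃cont (by change (g₂ _ : ℂ) = _; rw [hp₂])]
    have h3' : ‖fourierCoeffOn hperiod G₃ k‖ ≤ B₃ :=
      norm_fourierCoeffOn_period_le (fun x => by
        change ‖(g₃ x : ℂ)‖ ≤ B₃; rw [Complex.norm_real, Real.norm_eq_abs]; exact h3 x) k
    have hk' : (k : ℝ) ≠ 0 := by exact_mod_cast hk
    have hnI : ‖(1 : ℂ) / (I * k)‖ = 1 / |(k : ℝ)| := by
      rw [norm_div, norm_one, norm_mul, Complex.norm_I, one_mul, Complex.norm_intCast]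
    rw [norm_mul, norm_mul, norm_mul, hnI]
    have hk0 : 0 < |(k : ℝ)| := abs_pos.mpr hk'
    calc 1 / |(k : ℝ)| * (1 / |(k : ℝ)| * (1 / |(k : ℝ)| * ‖fourierCoeffOn hperiod G₃ k‖))
        = ‖fourierCoeffOn hperiod G₃ k‖ / |(k : ℝ)| ^ 3 := by field_simp
      _ ≤ B₃ / |(k : ℝ)| ^ 3 := div_le_div_of_nonneg_right h3' (by positivity)
  -- summability
  have hB₀ : 0 ≤ B₀ := (abs_nonneg _).trans (h0 0)
  have hB₃ : 0 ≤ B₃ := (abs_nonneg _).trans (h3 0)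
  have hsum : Summable fun k => ‖c k‖ := by
    have hmaj : Summable fun k : ℤ => B₀ * (if k = 0 then (1 : ℝ) else 0) + B₃ * |1 / (k : ℝ) ^ 3| := by
      refine Summable.add ?_ ?_
      · refine (summable_of_ne_finset_zero (s := {0}) fun k hk => ?_).mul_left B₀
        rw [Finset.mem_singleton] at hk; rw [if_neg hk]
      · exact ((Real.summable_one_div_int_pow.mpr (by norm_num : 1 < 3)).abs).mul_left B₃
    refine Summable.of_nonneg_of_le (fun k => norm_nonneg _) (fun k => ?_) hmaj
    by_cases hk : k = 0
    · subst hk; simp; exact hc0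
    · rw [if_neg hk, mul_zero, zero_add]
      refine (hck k hk).trans (le_of_eq ?_)
      rw [abs_div, abs_one, abs_pow, ← div_eq_mul_one_div]
  refine ⟨c, hc0, hck, hsum, fun θ hθ => ?_⟩
  -- pointwise convergence
  have hsum' : Summable (fourierCoeff (Fc : AddCircle (2 * π) → ℂ)) := by
    rw [← hc]; exact hsum.of_norm
  have hpt := has_pointwise_sum_fourier_series_of_summable hsum' (θ : AddCircle (2 * π))
  have hFθ : Fc (θ : AddCircle (2 * π)) = (g θ : ℂ) := by
    change F θ = _
    rw [hF, AddCircle.liftIoc_coe_apply]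
    rwa [show -π + 2 * π = π by ring]
  rw [hFθ] at hpt
  convert hpt using 2 with k
  rw [← hc, smul_eq_mul, fourier_coe_apply]
  congr 1
  have hπ : (π : ℂ) ≠ 0 := by exact_mod_cast Real.pi_pos.ne'
  push_cast
  field_simp

/-! ### A smooth window for a quarter-arc -/

/-- The profile of the window: `h(u) = χ_{q,Δ}(u) - χ_{q+π/2-Δ,Δ}(u)` — rises on `[q, q+Δ]`, equals `1`
on `[q+Δ, q+π/2-Δ]`, falls on `[q+π/2-Δ, q+π/2]`, vanishes off `(q, q+π/2)`.
[cite: FriedlanderIwaniecAnnals1998, §23 after (23.3)] -/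
def quadProfile (q Δ : ℝ) (u : ℝ) : ℝ := fiStep q Δ u - fiStep (q + π / 2 - Δ) Δ u

/-- **The smooth window** for the quarter-arc `(q, q + π/2)` inside the period window `(c, c + 2π]`:
the `2π`-periodisation of `quadProfile q Δ`. [cite: FriedlanderIwaniecAnnals1998, §23 after (23.3)] -/
def quadWin (c q Δ : ℝ) : ℝ → ℝ := angPeriodize c (quadProfile q Δ)

section quadWin

variable {c q Δ : ℝ}

/-- `h = 0` left of `q`. [cite: FriedlanderIwaniecAnnals1998, §23 after (23.3)] -/
theorem quadProfile_eq_zero_of_le (hΔ : 0 < Δ) (hΔ' : Δ ≤ π / 4) {u : ℝ} (hu : u ≤ q) :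
    quadProfile q Δ u = 0 := by
  have hπ := Real.pi_pos
  rw [quadProfile, fiStep_eq_zero hΔ hu, fiStep_eq_zero hΔ (by linarith)]; ring

/-- `h = 0` right of `q + π/2`. [cite: FriedlanderIwaniecAnnals1998, §23 after (23.3)] -/
theorem quadProfile_eq_zero_of_ge (hΔ : 0 < Δ) (hΔ' : Δ ≤ π / 4) {u : ℝ} (hu : q + π / 2 ≤ u) :
    quadProfile q Δ u = 0 := by
  have hπ := Real.pi_pos
  rw [quadProfile, fiStep_eq_one hΔ (by linarith), fiStep_eq_one hΔ (by linarith)]; ring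

/-- `h = 1` on `[q + Δ, q + π/2 - Δ]`. [cite: FriedlanderIwaniecAnnals1998, §23 after (23.3)] -/
theorem quadProfile_eq_one (hΔ : 0 < Δ) {u : ℝ} (hu₁ : q + Δ ≤ u) (hu₂ : u ≤ q + π / 2 - Δ) :
    quadProfile q Δ u = 1 := by
  rw [quadProfile, fiStep_eq_one hΔ hu₁, fiStep_eq_zero hΔ hu₂]; ring

/-- `0 ≤ h ≤ 1`. [cite: FriedlanderIwaniecAnnals1998, §23 after (23.3)] -/
theorem quadProfile_mem_Icc (hΔ : 0 < Δ) (hΔ' : Δ ≤ π / 4) (u : ℝ) : quadProfile q Δ u ∈ Set.Icc 0 1 := by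
  have hπ := Real.pi_pos
  refine ⟨?_, ?_⟩
  · have := fiStep_anti_left hΔ (show q ≤ q + π / 2 - Δ by linarith) u
    rw [quadProfile]; linarith
  · have := fiStep_le_one q Δ u
    have := fiStep_nonneg (q + π / 2 - Δ) Δ u
    rw [quadProfile]; linarith

/-- The support of `h`: nonzero values only on `(q, q + π/2)`. [cite: FriedlanderIwaniecAnnals1998, §23 after (23.3)] -/
theorem quadProfile_support (hΔ : 0 < Δ) (hΔ' : Δ ≤ π / 4) {u : ℝ} (hu : quadProfile q Δ u ≠ 0) :
    q < u ∧ u < q + π / 2 := by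
  by_contra h
  rw [not_and_or, not_lt, not_lt] at h
  rcases h with h | h
  · exact hu (quadProfile_eq_zero_of_le hΔ hΔ' h)
  · exact hu (quadProfile_eq_zero_of_ge hΔ hΔ' h)

/-- `h` is smooth. [cite: FriedlanderIwaniecAnnals1998, §23 after (23.3)] -/
theorem contDiff_quadProfile (q Δ : ℝ) {n : ℕ∞} : ContDiff ℝ n (quadProfile q Δ) :=
  (contDiff_fiStep q Δ).sub (contDiff_fiStep _ Δ)

/-- `h` is supported inside the window `(c + 1, c + 2π - 1)` when `c + 1 ≤ q` and `q + π/2 ≤ c + 2π - 1`.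
[cite: FriedlanderIwaniecAnnals1998, §23 after (23.3)] -/
theorem windowSupp_quadProfile (hΔ : 0 < Δ) (hΔ' : Δ ≤ π / 4) (hcq : c + 1 ≤ q)
    (hqc : q + π / 2 ≤ c + 2 * π - 1) : WindowSupp c 1 (quadProfile q Δ) := by
  intro v hv
  obtain ⟨h1, h2⟩ := quadProfile_support hΔ hΔ' hv
  exact ⟨by linarith, by linarith⟩

/-- The third derivative of the smooth step: `χ'''_{a,δ}(u) = ψ'''((u-a)/δ)/δ³`. [cite: FriedlanderIwaniecAnnals1998, §23 after (23.3)] -/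
theorem deriv3_fiStep (a δ : ℝ) :
    deriv (deriv (deriv (fiStep a δ))) =
      fun u => deriv (deriv (deriv Real.smoothTransition)) ((u - a) / δ) / δ / δ / δ := by
  rw [deriv_deriv_fiStep]
  funext u
  have hlin : HasDerivAt (fun u : ℝ => (u - a) / δ) (1 / δ) u :=
    ((hasDerivAt_id u).sub_const a).div_const δ
  have hψ2 : ContDiff ℝ 1 (deriv (deriv Real.smoothTransition)) :=
    ((Real.smoothTransition.contDiff (n := 3)).deriv').deriv'
  have hψ'' : HasDerivAt (deriv (deriv Real.smoothTransition))
      (deriv (deriv (deriv Real.smoothTransition)) ((u - a) / δ)) ((u - a) / δ) :=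
    ((hψ2.differentiable (by norm_num)) _).hasDerivAt
  have h := (((hψ''.comp u hlin).div_const δ).div_const δ).deriv
  rw [mul_one_div] at h
  exact h

/-- A bound `M ≥ 1` for `|ψ'''|`. [cite: FriedlanderIwaniecAnnals1998, §23 after (23.3)] -/
theorem exists_bound_deriv3_smoothTransition :
    ∃ M : ℝ, 1 ≤ M ∧ ∀ s, |deriv (deriv (deriv Real.smoothTransition)) s| ≤ M := by
  obtain ⟨M, hM1, hM⟩ := exists_bound_iteratedFDeriv_smoothTransition 3
  refine ⟨M, hM1, fun s => ?_⟩
  have h := hM 3 le_rfl s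
  rw [norm_iteratedFDeriv_eq_norm_iteratedDeriv] at h
  have e : iteratedDeriv 3 Real.smoothTransition = deriv (deriv (deriv Real.smoothTransition)) := by
    rw [show (3 : ℕ) = 2 + 1 from rfl, iteratedDeriv_succ, show (2 : ℕ) = 1 + 1 from rfl,
      iteratedDeriv_succ, iteratedDeriv_one]
  rwa [e, Real.norm_eq_abs] at h

/-- `|h'''| ≤ 2M/Δ³`. [cite: FriedlanderIwaniecAnnals1998, §23 after (23.3)] -/
theorem abs_deriv3_quadProfile_le {M : ℝ} (hM : ∀ s, |deriv (deriv (deriv Real.smoothTransition)) s| ≤ M)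
    (hΔ : 0 < Δ) (u : ℝ) : |deriv (deriv (deriv (quadProfile q Δ))) u| ≤ 2 * M / Δ ^ 3 := by
  have hsub : quadProfile q Δ = fun u => fiStep q Δ u - fiStep (q + π / 2 - Δ) Δ u := rfl
  have hcd : ∀ a : ℝ, ContDiff ℝ 3 (fiStep a Δ) := fun a => contDiff_fiStep a Δ
  have hd : ∀ a : ℝ, Differentiable ℝ (fiStep a Δ) := fun a => (hcd a).differentiable (by norm_num)
  have hcd2 : ∀ a : ℝ, ContDiff ℝ 2 (deriv (fiStep a Δ)) := fun a => (hcd a).deriv'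
  have hcd1 : ∀ a : ℝ, ContDiff ℝ 1 (deriv (deriv (fiStep a Δ))) := fun a => (hcd2 a).deriv'
  have hd1 : ∀ a : ℝ, Differentiable ℝ (deriv (fiStep a Δ)) := fun a =>
    (hcd2 a).differentiable (by norm_num)
  have hd2 : ∀ a : ℝ, Differentiable ℝ (deriv (deriv (fiStep a Δ))) := fun a =>
    (hcd1 a).differentiable (by norm_num)
  have e1 : deriv (quadProfile q Δ) = fun u => deriv (fiStep q Δ) u - deriv (fiStep (q + π / 2 - Δ) Δ) u := by
    funext u; rw [hsub]; exact deriv_sub ((hd q) u) ((hd _) u)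
  have e2 : deriv (deriv (quadProfile q Δ)) =
      fun u => deriv (deriv (fiStep q Δ)) u - deriv (deriv (fiStep (q + π / 2 - Δ) Δ)) u := by
    rw [e1]; funext u; exact deriv_sub ((hd1 q) u) ((hd1 _) u)
  have e3 : deriv (deriv (deriv (quadProfile q Δ))) =
      fun u => deriv (deriv (deriv (fiStep q Δ))) u - deriv (deriv (deriv (fiStep (q + π / 2 - Δ) Δ))) u := by
    rw [e2]; funext u; exact deriv_sub ((hd2 q) u) ((hd2 _) u)
  rw [e3]
  simp only [deriv3_fiStep]
  have hΔ3 : 0 < Δ ^ 3 := by positivity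
  have hb : ∀ s : ℝ, |deriv (deriv (deriv Real.smoothTransition)) s / Δ / Δ / Δ| ≤ M / Δ ^ 3 := by
    intro s
    rw [show deriv (deriv (deriv Real.smoothTransition)) s / Δ / Δ / Δ =
      deriv (deriv (deriv Real.smoothTransition)) s / Δ ^ 3 by field_simp, abs_div,
      abs_of_pos hΔ3]
    exact div_le_div_of_nonneg_right (hM s) hΔ3.le
  calc |deriv (deriv (deriv Real.smoothTransition)) ((u - q) / Δ) / Δ / Δ / Δ -
        deriv (deriv (deriv Real.smoothTransition)) ((u - (q + π / 2 - Δ)) / Δ) / Δ / Δ / Δ|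
      ≤ |deriv (deriv (deriv Real.smoothTransition)) ((u - q) / Δ) / Δ / Δ / Δ| +
        |deriv (deriv (deriv Real.smoothTransition)) ((u - (q + π / 2 - Δ)) / Δ) / Δ / Δ / Δ| :=
        abs_sub _ _
    _ ≤ M / Δ ^ 3 + M / Δ ^ 3 := add_le_add (hb _) (hb _)
    _ = 2 * M / Δ ^ 3 := by ring

/-- `quadWin` is `2π`-periodic. [cite: FriedlanderIwaniecAnnals1998, §23 after (23.3)] -/
theorem quadWin_periodic (c q Δ : ℝ) : Function.Periodic (quadWin c q Δ) (2 * π) :=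
  angPeriodize_periodic c _

/-- `quadWin` is smooth (under the window hypotheses). [cite: FriedlanderIwaniecAnnals1998, §23 after (23.3)] -/
theorem contDiff_quadWin (hΔ : 0 < Δ) (hΔ' : Δ ≤ π / 4) (hcq : c + 1 ≤ q) (hqc : q + π / 2 ≤ c + 2 * π - 1)
    {n : ℕ∞} : ContDiff ℝ n (quadWin c q Δ) :=
  contDiff_angPeriodize one_pos (by linarith [Real.pi_gt_three]) (windowSupp_quadProfile hΔ hΔ' hcq hqc)
    (contDiff_quadProfile q Δ)

/-- `quadWin θ = h(θ mod 2π ∈ (c, c + 2π])`. [cite: FriedlanderIwaniecAnnals1998, §23 after (23.3)] -/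
theorem quadWin_eq (c q Δ θ : ℝ) : quadWin c q Δ θ = quadProfile q Δ (toIocMod Real.two_pi_pos c θ) := rfl

/-- `0 ≤ quadWin ≤ 1`. [cite: FriedlanderIwaniecAnnals1998, §23 after (23.3)] -/
theorem quadWin_mem_Icc (hΔ : 0 < Δ) (hΔ' : Δ ≤ π / 4) (θ : ℝ) : quadWin c q Δ θ ∈ Set.Icc 0 1 :=
  quadProfile_mem_Icc hΔ hΔ' _

/-- `|quadWin'''| ≤ 2M/Δ³`. [cite: FriedlanderIwaniecAnnals1998, §23 after (23.3)] -/
theorem abs_deriv3_quadWin_le {M : ℝ} (hM : ∀ s, |deriv (deriv (deriv Real.smoothTransition)) s| ≤ M)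
    (hΔ : 0 < Δ) (hΔ' : Δ ≤ π / 4) (hcq : c + 1 ≤ q) (hqc : q + π / 2 ≤ c + 2 * π - 1) (θ : ℝ) :
    |deriv (deriv (deriv (quadWin c q Δ))) θ| ≤ 2 * M / Δ ^ 3 := by
  have hπ := Real.pi_gt_three
  have hW := windowSupp_quadProfile hΔ hΔ' hcq hqc
  have hW1 := hW.deriv one_pos
  have hW2 := hW1.deriv (by norm_num)
  have e1 : deriv (quadWin c q Δ) = angPeriodize c (deriv (quadProfile q Δ)) :=
    deriv_angPeriodize_eq one_pos (by linarith) hW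
  have e2 : deriv (deriv (quadWin c q Δ)) = angPeriodize c (deriv (deriv (quadProfile q Δ))) := by
    rw [e1]; exact deriv_angPeriodize_eq (by norm_num) (by linarith) hW1
  have e3 : deriv (deriv (deriv (quadWin c q Δ))) =
      angPeriodize c (deriv (deriv (deriv (quadProfile q Δ)))) := by
    rw [e2]; exact deriv_angPeriodize_eq (by norm_num) (by linarith) hW2
  rw [e3]
  exact abs_deriv3_quadProfile_le hM hΔ _

/-- **Fourier expansion of the window**: `quadWin(θ) = Σ_k ĝ(k) e^{ikθ}` (`θ ∈ (-π, π]`) with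
`|ĝ(0)| ≤ 1`, `|ĝ(k)| ≤ (2M/Δ³)/|k|³`, `M` the bound of `exists_bound_deriv3_smoothTransition`.
[cite: FriedlanderIwaniecAnnals1998, §23 after (23.3)] -/
theorem hasSum_fourier_quadWin {M : ℝ} (hM : ∀ s, |deriv (deriv (deriv Real.smoothTransition)) s| ≤ M)
    (hΔ : 0 < Δ) (hΔ' : Δ ≤ π / 4) (hcq : c + 1 ≤ q) (hqc : q + π / 2 ≤ c + 2 * π - 1) :
    ∃ ĝ : ℤ → ℂ, ‖ĝ 0‖ ≤ 1 ∧ (∀ k : ℤ, k ≠ 0 → ‖ĝ k‖ ≤ (2 * M / Δ ^ 3) / |(k : ℝ)| ^ 3) ∧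
      (Summable fun k => ‖ĝ k‖) ∧
      ∀ θ : ℝ, θ ∈ Set.Ioc (-π) π →
        HasSum (fun k : ℤ => ĝ k * Complex.exp (k * θ * I)) (quadWin c q Δ θ) :=
  hasSum_fourier_of_periodic (quadWin_periodic c q Δ) (contDiff_quadWin hΔ hΔ' hcq hqc)
    (fun u => by
      obtain ⟨h0, h1⟩ := quadWin_mem_Icc (c := c) (q := q) hΔ hΔ' u
      rw [abs_of_nonneg h0]; exact h1)
    (abs_deriv3_quadWin_le hM hΔ hΔ' hcq hqc)

end quadWin

end Literature.NumberTheory.Sieve.FriedlanderIwaniecPrimes
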